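import Summits.HubbardSuperconductivity.HubbardSuperconductivity.Theorems.LogColdTorusLogColdDWaveOrderSectorPairDecay
import Summits.HubbardSuperconductivity.HubbardSuperconductivity.Theorems.LogColdTorusLogScaleNecessity
import HarnessLib

/-!
# Route `LogColdTorus`, crux `LogColdDWaveOrder` (stmt-HubbardSuperconductivity-8807):
# necessity of the log scale and of the threshold `κ₀`, IN THE CRUX'S OWN (canonical-sector) ENSEMBLE

Consequences of the sector Koma–Tasaki bound `logColdSector_pairDecay`
(`Theorems/LogColdTorusLogColdDWaveOrderSectorPairDecay.lean`) for the exact functional of the crux,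
`L ↦ Re ω^{p}_{β,L}(Δ_d†Δ_d) := (Matrix.gibbsState β ((hubbardTorus 2 L 1 U).toBlock p p)
((Δ_d†Δ_d).toBlock p p)).re`, for EVERY family of occupation predicates `p = p_L` (in particular the
crux's `(N_L, S^z = 0)` sector):

* `re_gibbsState_toBlock_pairField_le` — `Re ω^{p}_{β,L}(Δ_d†Δ_d) ≤ C_d L² (9L + L² (√L)^{-f(β)})`;
* `logColdSector_logScaleNecessity` (registered) — SECTOR LOG-SCALE NECESSITY: order `c·L⁴` at
  inverse temperature `β ≥ 0` forces `β ≥ κ₁ log L` for `L ≥ L₀`, with `κ₁, L₀` depending on `c`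
  only (not on `U`, `δ`, the sector or `β`) — the canonical twin of support `LogScaleNecessity`;
* `logColdSector_noFixedBetaOrder` — hence NO sector pair order at any FIXED `β` eventually in `L`
  (the canonical twin of the barrier `PositiveTemperatureNoPairLRO` for the crux's objects);
* `logColdSector_orderConstant_le` (registered) — the `κ`-CEILING: log-cold order `c·L⁴` at
  `β_L = κ log L` eventually in even `L` forces `c ≤ C_d · e^{-1/(256 κ)}` — Mermin–Wagner read at
  the threshold is the rigorous upper half of the route's scaling law `m²(κ) = m_∞² e^{-1/(2πκρ_s)}`;
(The refuted strengthening — one `c` for every `κ > 0` is impossible, so the crux's `∃ κ₀ > 0` is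
load-bearing — is drawn in the sibling file `LogColdTorusLogColdDWaveOrderThresholdNecessity.lean`.)

Sources: T. Koma, H. Tasaki, PRL 68 (1992) 3248 (Theorem, eq. (2)–(3), p. 3: "the power indices are
proportional to β⁻¹"); O. McBryan, T. Spencer, CMP 53 (1977) 299; S. T. Bramwell,
P. C. W. Holdsworth, J. Phys.: Condens. Matter 5 (1993) L53 (the `L^{-T/(8πJ)}` law). No definitions.
-/

-- the mandated namespace `Summit.<Summit>.<Problem>.Theorems` repeats `HubbardSuperconductivity`
-- (single-problem summit, D-0017), which the `dupNamespace` linter flags on every declaration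
set_option linter.dupNamespace false

noncomputable section

namespace Summit.HubbardSuperconductivity.HubbardSuperconductivity.Theorems.LogColdTorus

open Matrix Finset Filter NormedSpace Literature.MathematicalPhysics.QuantumLattice
  Literature.Probability.LatticeModels Literature.Barriers.HubbardSuperconductivity
  Summit.HubbardSuperconductivity.HubbardSuperconductivity.Theorems
open scoped Matrix.Norms.L2Operator ComplexOrder Topology

/-! ### The pair field in a sector -/

section PairField

variable {L : ℕ} [NeZero L]

/-- `ω(Δ_g†Δ_g block) = Σ_{x,y} ω(((P_x)† P_y) block)` for the Gibbs state of any block matrix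
(bilinearity and additivity of the compression). Scalapino, Phys. Rep. 250 (1995) 329, §2. [folklore] -/
theorem gibbsState_toBlock_pairField_eq (g : Site 2 → ℝ) (β : ℝ)
    (p : Finset (Orb (FermionTorus 2 L)) → Prop) [Fintype {s // p s}] [DecidableEq {s // p s}]
    (K : Matrix {s // p s} {s // p s} ℂ) :
    gibbsState β K (((pairField g L)ᴴ * pairField g L).toBlock p p) =
      ∑ x : TorusSite 2 L, ∑ y : TorusSite 2 L,
        gibbsState β K (((localPair g L x)ᴴ * localPair g L y).toBlock p p) := by
  rw [pairField, conjTranspose_sum, Finset.sum_mul, toBlock_sum, map_sum]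
  refine Finset.sum_congr rfl fun x _ => ?_
  rw [Finset.mul_sum, toBlock_sum, map_sum]

variable (L)

open scoped Classical in
/-- **Sector pair order is at most `9 C_d L³ + C_d L⁴ (√L)^{-f}`**: for `β ≥ 0`, every predicate
`p` on occupation sets and the Koma–Tasaki exponent `f = pairDecayExponent β`,
`Re ω^{p}_{β,L}(Δ_d†Δ_d) ≤ C_d · L² · (9L + L² · (√L)^{-f})` — the sector decay bound summed with
cut-off radius `R = ⌊√L⌋` (on an empty block the left side is the junk value `0`).
[cite: KomaTasakiPRL1992, Theorem eq. (2)–(3) and remark after it] -/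
theorem re_gibbsState_toBlock_pairField_le (U : ℝ) {β : ℝ} (hβ : 0 ≤ β)
    (p : Finset (Orb (FermionTorus 2 L)) → Prop) [DecidablePred p] :
    (gibbsState β ((hubbardTorus 2 L 1 U).toBlock p p)
        (((pairField dWaveFormFactor L)ᴴ * pairField dWaveFormFactor L).toBlock p p)).re ≤
      pairFieldDecayConst dWaveFormFactor * ((L : ℝ) ^ 2 *
        (9 * (L : ℝ) + (L : ℝ) ^ 2 * (Real.sqrt L) ^ (-pairDecayExponent (β * |(1 : ℝ)|)))) := by
  set C : ℝ := pairFieldDecayConst dWaveFormFactor with hC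
  set f : ℝ := pairDecayExponent (β * |(1 : ℝ)|) with hf
  have hC0 : 0 ≤ C := pairFieldDecayConst_nonneg _
  have hf0 : 0 < f := pairDecayExponent_pos (by positivity)
  have hL1 : (1 : ℝ) ≤ (L : ℝ) := by exact_mod_cast NeZero.one_le
  -- the empty block: junk value `0`
  rcases isEmpty_or_nonempty {s // p s} with hp | hp
  · have h0 : ((pairField dWaveFormFactor L)ᴴ * pairField dWaveFormFactor L).toBlock p p = 0 :=
      Subsingleton.elim _ _
    rw [h0, map_zero, Complex.zero_re]
    positivity
  have hsq1 : 1 ≤ Real.sqrt L := by rw [← Real.sqrt_one]; exact Real.sqrt_le_sqrt hL1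
  have hsq0 : 0 < Real.sqrt L := by linarith
  -- cut-off radius
  set R : ℕ := ⌊Real.sqrt L⌋₊ with hR
  have hRle : (R : ℝ) ≤ Real.sqrt L := Nat.floor_le hsq0.le
  have hRlt : Real.sqrt L < (R : ℝ) + 1 := Nat.lt_floor_add_one _
  -- row sums
  have hrow : ∀ x : TorusSite 2 L,
      ∑ y : TorusSite 2 L, ((torusDist x y : ℝ) + 1) ^ (-f) ≤
        9 * (L : ℝ) + (L : ℝ) ^ 2 * (Real.sqrt L) ^ (-f) := by
    intro x
    refine (sum_rpow_torusDist_le L x hf0.le R).trans ?_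
    have h1 : (2 * R + 1 : ℝ) ^ 2 ≤ 9 * (L : ℝ) := by
      have : (2 * R + 1 : ℝ) ≤ 3 * Real.sqrt L := by linarith
      calc (2 * R + 1 : ℝ) ^ 2 ≤ (3 * Real.sqrt L) ^ 2 := by gcongr
        _ = 9 * (L : ℝ) := by
            rw [mul_pow, Real.sq_sqrt (by positivity)]; norm_num
    have h2 : ((R : ℝ) + 1) ^ (-f) ≤ (Real.sqrt L) ^ (-f) :=
      Real.rpow_le_rpow_of_nonpos hsq0 hRlt.le (by linarith)
    have h3 : (L : ℝ) ^ 2 * ((R : ℝ) + 1) ^ (-f) ≤ (L : ℝ) ^ 2 * (Real.sqrt L) ^ (-f) :=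
      mul_le_mul_of_nonneg_left h2 (by positivity)
    linarith [h1, h3]
  -- the double sum
  have hcard : (Fintype.card (TorusSite 2 L) : ℝ) = (L : ℝ) ^ 2 := by
    simp only [Fintype.card_pi, ZMod.card, Finset.prod_const, Finset.card_univ, Fintype.card_fin]
    push_cast
    rfl
  have hdouble : ∑ x : TorusSite 2 L, ∑ y : TorusSite 2 L, ((torusDist x y : ℝ) + 1) ^ (-f) ≤
      (L : ℝ) ^ 2 * (9 * (L : ℝ) + (L : ℝ) ^ 2 * (Real.sqrt L) ^ (-f)) := by
    calc ∑ x : TorusSite 2 L, ∑ y : TorusSite 2 L, ((torusDist x y : ℝ) + 1) ^ (-f)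
        ≤ ∑ _x : TorusSite 2 L, (9 * (L : ℝ) + (L : ℝ) ^ 2 * (Real.sqrt L) ^ (-f)) :=
          Finset.sum_le_sum fun x _ => hrow x
      _ = (L : ℝ) ^ 2 * (9 * (L : ℝ) + (L : ℝ) ^ 2 * (Real.sqrt L) ^ (-f)) := by
          rw [Finset.sum_const, nsmul_eq_mul, Finset.card_univ, hcard]
  -- the decay bound, term by term
  rw [gibbsState_toBlock_pairField_eq, Complex.re_sum]
  calc ∑ x : TorusSite 2 L, (∑ y : TorusSite 2 L,
        gibbsState β ((hubbardTorus 2 L 1 U).toBlock p p)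
          (((localPair dWaveFormFactor L x)ᴴ * localPair dWaveFormFactor L y).toBlock p p)).re
      ≤ ∑ x : TorusSite 2 L, ∑ y : TorusSite 2 L, C * ((torusDist x y : ℝ) + 1) ^ (-f) := by
        refine Finset.sum_le_sum fun x _ => ?_
        rw [Complex.re_sum]
        refine Finset.sum_le_sum fun y _ => ?_
        exact (Complex.re_le_norm _).trans
          (norm_gibbsState_toBlock_hubbardTorus_localPairCorr_le dWaveFormFactor 1 U hβ p x y)
    _ = C * ∑ x : TorusSite 2 L, ∑ y : TorusSite 2 L, ((torusDist x y : ℝ) + 1) ^ (-f) := by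
        rw [Finset.mul_sum]
        refine Finset.sum_congr rfl fun x _ => ?_
        rw [Finset.mul_sum]
    _ ≤ C * ((L : ℝ) ^ 2 * (9 * (L : ℝ) + (L : ℝ) ^ 2 * (Real.sqrt L) ^ (-f))) :=
        mul_le_mul_of_nonneg_left hdouble hC0

end PairField

/-! ### Sector log-scale necessity -/

open scoped Classical in
/-- **SECTOR LOG-SCALE NECESSITY** (registered sub-goal `logColdSector_logScaleNecessity` of crux
`LogColdDWaveOrder`; the canonical twin of support `LogScaleNecessity`): for every `c > 0` there are
`κ₁ > 0` and `L₀` — depending on `c` ONLY — such that for all `U`, all `L ≥ L₀`, every predicate `p`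
on occupation sets of the torus and every `β ≥ 0`, sector `d`-wave order
`c·L⁴ ≤ Re ω^{p}_{β,L}(Δ_d†Δ_d)` of the compressed pure Hubbard Hamiltonian forces `κ₁ log L ≤ β`.
Constants: `κ₁ = 1/(512K)`, `K = max(1, log(8C_d/c))`, `L₀ > max(e^{4K}, 32C_d/c)`. So along the
crux's scaling `β_L = κ log L` the hypothesis `κ ≥ κ₀ > 0` cannot be dropped below `κ₁(c)`.
[cite: KomaTasakiPRL1992, Theorem eq. (2)–(3) and p. 3] -/
theorem logColdSector_logScaleNecessity :
    ∀ c : ℝ, 0 < c → ∃ κ₁ : ℝ, 0 < κ₁ ∧ ∃ L₀ : ℕ, ∀ (U : ℝ) (L : ℕ) [NeZero L], L₀ ≤ L →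
      ∀ (p : Finset (Orb (FermionTorus 2 L)) → Prop) [DecidablePred p] (β : ℝ), 0 ≤ β →
        c * (L : ℝ) ^ 4 ≤ (Matrix.gibbsState β ((hubbardTorus 2 L 1 U).toBlock p p)
          (((pairField dWaveFormFactor L)ᴴ * pairField dWaveFormFactor L).toBlock p p)).re →
        κ₁ * Real.log L ≤ β := by
  intro c hc
  set C : ℝ := pairFieldDecayConst dWaveFormFactor with hC
  have hC0 : 0 ≤ C := pairFieldDecayConst_nonneg _
  set K : ℝ := max 1 (Real.log (8 * C / c)) with hK
  have hK1 : 1 ≤ K := le_max_left _ _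
  have hK0 : 0 < K := by linarith
  -- `C e^{-K} ≤ c/8`
  have hCK : C * Real.exp (-K) ≤ c / 8 := by
    rcases hC0.eq_or_lt with h0 | hCpos
    · rw [← h0, zero_mul]; positivity
    · have h8 : 0 < 8 * C / c := by positivity
      have : Real.exp (-K) ≤ c / (8 * C) := by
        calc Real.exp (-K) ≤ Real.exp (-Real.log (8 * C / c)) :=
              Real.exp_le_exp.mpr (neg_le_neg (le_max_right _ _))
          _ = c / (8 * C) := by rw [Real.exp_neg, Real.exp_log h8, inv_div]
      calc C * Real.exp (-K) ≤ C * (c / (8 * C)) := mul_le_mul_of_nonneg_left this hC0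
        _ = c / 8 := by field_simp
  refine ⟨1 / (512 * K), by positivity, ?_⟩
  obtain ⟨L₀, hL₀⟩ := exists_nat_gt (max (Real.exp (4 * K)) (32 * C / c))
  refine ⟨L₀, fun U L _ hL p _ β hβ hord => ?_⟩
  have hL₀' : (L₀ : ℝ) ≤ (L : ℝ) := by exact_mod_cast hL
  have hLexp : Real.exp (4 * K) < (L : ℝ) := (le_max_left _ _).trans_lt (hL₀.trans_le hL₀')
  have hLC : 32 * C / c < (L : ℝ) := (le_max_right _ _).trans_lt (hL₀.trans_le hL₀')
  have hLpos : (0 : ℝ) < (L : ℝ) := (Real.exp_pos _).trans hLexp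
  have hlog : 4 * K < Real.log L := by
    rw [Real.lt_log_iff_exp_lt hLpos]; exact hLexp
  by_contra hlt
  push Not at hlt
  -- the exponent
  set f : ℝ := pairDecayExponent (β * |(1 : ℝ)|) with hf
  have hβ1 : β * |(1 : ℝ)| = β := by rw [abs_one, mul_one]
  have hf0 : 0 < f := pairDecayExponent_pos (by positivity)
  have hfl : 1 / (1 + 128 * β) ≤ f := by
    rw [hf, hβ1]; exact inv_le_pairDecayExponent hβ
  -- `f · log L ≥ 2K`
  have hlogpos : 0 < Real.log L := by linarith
  have hkey : 2 * K ≤ f * Real.log L := by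
    by_contra hcon
    push Not at hcon
    have hden : 0 < 1 + 128 * β := by positivity
    have e1 : 1 / (1 + 128 * β) * (Real.log L * (1 + 128 * β)) = Real.log L := by
      rw [div_mul_eq_mul_div, one_mul, mul_div_assoc, div_self hden.ne', mul_one]
    have h1 : Real.log L ≤ f * Real.log L * (1 + 128 * β) := by
      have := mul_le_mul_of_nonneg_right hfl (mul_pos hlogpos hden).le
      rw [e1] at this
      linarith
    have h2 : f * Real.log L * (1 + 128 * β) < 2 * K * (1 + 128 * β) :=
      mul_lt_mul_of_pos_right hcon hden
    have e2 : 256 * K * (1 / (512 * K) * Real.log L) = Real.log L / 2 := by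
      field_simp; ring
    have h3 := mul_lt_mul_of_pos_left hlt (by positivity : (0 : ℝ) < 256 * K)
    rw [e2] at h3
    linarith
  -- `(√L)^{-f} ≤ e^{-K}`
  have hsqrt : (Real.sqrt L) ^ (-f) ≤ Real.exp (-K) := by
    rw [Real.rpow_def_of_pos (Real.sqrt_pos.mpr hLpos), Real.log_sqrt hLpos.le]
    refine Real.exp_le_exp.mpr ?_
    have : Real.log L / 2 * -f = -(f * Real.log L) / 2 := by ring
    rw [this]
    linarith
  -- assemble
  haveI : NeZero L := ⟨by rintro rfl; simp at hLpos⟩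
  have hmain := re_gibbsState_toBlock_pairField_le L U hβ p
  rw [← hC, ← hf] at hmain
  have hL4 : c * (L : ℝ) ^ 4 ≤
      C * ((L : ℝ) ^ 2 * (9 * (L : ℝ) + (L : ℝ) ^ 2 * (Real.sqrt L) ^ (-f))) :=
    hord.trans hmain
  have hT2 : C * ((L : ℝ) ^ 2 * ((L : ℝ) ^ 2 * (Real.sqrt L) ^ (-f))) ≤ c / 8 * (L : ℝ) ^ 4 := by
    calc C * ((L : ℝ) ^ 2 * ((L : ℝ) ^ 2 * (Real.sqrt L) ^ (-f)))
        = (C * (Real.sqrt L) ^ (-f)) * (L : ℝ) ^ 4 := by ring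
      _ ≤ (C * Real.exp (-K)) * (L : ℝ) ^ 4 :=
          mul_le_mul_of_nonneg_right (mul_le_mul_of_nonneg_left hsqrt hC0) (by positivity)
      _ ≤ c / 8 * (L : ℝ) ^ 4 := mul_le_mul_of_nonneg_right hCK (by positivity)
  have hT1 : C * ((L : ℝ) ^ 2 * (9 * (L : ℝ))) < 7 * c / 8 * (L : ℝ) ^ 4 := by
    have hL3 : (0 : ℝ) < (L : ℝ) ^ 3 := by positivity
    have h72 : 9 * C < 7 * c / 8 * (L : ℝ) := by
      have : 32 * C < c * (L : ℝ) := by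
        have := (div_lt_iff₀ hc).mp hLC; linarith
      nlinarith
    calc C * ((L : ℝ) ^ 2 * (9 * (L : ℝ))) = 9 * C * (L : ℝ) ^ 3 := by ring
      _ < 7 * c / 8 * (L : ℝ) * (L : ℝ) ^ 3 := mul_lt_mul_of_pos_right h72 hL3
      _ = 7 * c / 8 * (L : ℝ) ^ 4 := by ring
  have : C * ((L : ℝ) ^ 2 * (9 * (L : ℝ) + (L : ℝ) ^ 2 * (Real.sqrt L) ^ (-f))) <
      c * (L : ℝ) ^ 4 := by
    rw [mul_add, mul_add]
    linarith
  linarith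

open scoped Classical in
/-- **No sector pair order at fixed temperature** (canonical twin of the barrier
`PositiveTemperatureNoPairLRO` / `HohenbergMerminWagnerPairing` for the crux's exact objects): for
every `c > 0` and `β ≥ 0` there is `L₁` (depending on `c`, `β` only) such that for all `U`, all
`L ≥ L₁` and every occupation predicate `p`, `Re ω^{p}_{β,L}(Δ_d†Δ_d) < c·L⁴`.
[cite: KomaTasakiPRL1992, Theorem eq. (2)–(3)] -/
theorem logColdSector_noFixedBetaOrder :
    ∀ (c β : ℝ), 0 < c → 0 ≤ β → ∃ L₁ : ℕ, ∀ (U : ℝ) (L : ℕ) [NeZero L], L₁ ≤ L →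
      ∀ (p : Finset (Orb (FermionTorus 2 L)) → Prop) [DecidablePred p],
        (Matrix.gibbsState β ((hubbardTorus 2 L 1 U).toBlock p p)
          (((pairField dWaveFormFactor L)ᴴ * pairField dWaveFormFactor L).toBlock p p)).re <
        c * (L : ℝ) ^ 4 := by
  intro c β hc hβ
  obtain ⟨κ₁, hκ₁, L₀, hL₀⟩ := logColdSector_logScaleNecessity c hc
  obtain ⟨L₁, hL₁⟩ := exists_nat_gt (max (L₀ : ℝ) (Real.exp (β / κ₁ + 1)))
  refine ⟨L₁, fun U L _ hL p _ => ?_⟩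
  have hL₁' : (L₁ : ℝ) ≤ (L : ℝ) := by exact_mod_cast hL
  have hLL₀ : L₀ ≤ L := by
    have : (L₀ : ℝ) < L := (le_max_left _ _).trans_lt (hL₁.trans_le hL₁')
    exact_mod_cast this.le
  have hLexp : Real.exp (β / κ₁ + 1) < (L : ℝ) := (le_max_right _ _).trans_lt (hL₁.trans_le hL₁')
  have hLpos : (0 : ℝ) < (L : ℝ) := (Real.exp_pos _).trans hLexp
  have hlog : β / κ₁ + 1 < Real.log L := by
    rw [Real.lt_log_iff_exp_lt hLpos]; exact hLexp
  by_contra hge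
  push Not at hge
  have h := hL₀ U L hLL₀ p β hβ hge
  have : β / κ₁ * κ₁ = β := div_mul_cancel₀ β hκ₁.ne'
  nlinarith

/-! ### The threshold ceiling on the log-cold order constant -/

/-- The Koma–Tasaki exponent at `β = κ log L` times `log L`:
`f(κ log L) · log L = (1/(128κ)) · (1 - 1/(1 + 128 κ log L)²)` (`f(b) = (2+128b)/(1+128b)²`).
[cite: KomaTasakiPRL1992, Theorem] -/
theorem pairDecayExponent_mul_log {κ l : ℝ} (hκ : 0 < κ) (hl : 0 ≤ l) :
    pairDecayExponent (κ * l) * l = 1 / (128 * κ) * (1 - 1 / (1 + 128 * (κ * l)) ^ 2) := by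
  unfold pairDecayExponent
  have h1 : (1 + 128 * (κ * l)) ≠ 0 := by positivity
  have hκ0 : κ ≠ 0 := hκ.ne'
  field_simp
  ring

open scoped Classical in
/-- **THE `κ`-CEILING ON LOG-COLD ORDER** (registered sub-goal `logColdSector_orderConstant_le` of
crux `LogColdDWaveOrder`; Mermin–Wagner at the Koma–Tasaki threshold = the rigorous upper half of the
scaling law `m²(κ) = m_∞² e^{-1/(2πκρ_s)}`): for every family `p_L` of occupation predicates, every
`U`, every `κ > 0` and every `c`, if `c·L⁴ ≤ Re ω^{p_L}_{κ log L, L}(Δ_d†Δ_d)` eventually along even `L`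
(the crux body at ONE `U`, ONE `κ`), then `c ≤ C_d · e^{-1/(256κ)}`, `C_d = pairFieldDecayConst
dWaveFormFactor = 32e²`. Proof: `re_gibbsState_toBlock_pairField_le` gives
`c ≤ 9C_d/L + C_d (√L)^{-f(κ log L)} = 9C_d/L + C_d exp(-(1/(256κ))(1 - (1+128κ log L)⁻²))` for all
large even `L`; let `L → ∞`. [cite: KomaTasakiPRL1992, Theorem eq. (2)–(3) and p. 3] -/
theorem logColdSector_orderConstant_le :
    ∀ (p : (L : ℕ) → Finset (Orb (FermionTorus 2 L)) → Prop) [∀ L, DecidablePred (p L)]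
      (U κ c : ℝ), 0 < κ →
      (∃ L₀ : ℕ, ∀ (L : ℕ) [NeZero L], L₀ ≤ L → Even L →
        c * (L : ℝ) ^ 4 ≤ (Matrix.gibbsState (κ * Real.log L)
          ((hubbardTorus 2 L 1 U).toBlock (p L) (p L))
          (((pairField dWaveFormFactor L)ᴴ * pairField dWaveFormFactor L).toBlock (p L) (p L))).re) →
      c ≤ pairFieldDecayConst dWaveFormFactor * Real.exp (-(1 / (256 * κ))) := by
  intro p _ U κ c hκ ⟨L₀, hL₀⟩
  set C : ℝ := pairFieldDecayConst dWaveFormFactor with hC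
  have hC0 : 0 ≤ C := pairFieldDecayConst_nonneg _
  set a : ℝ := 1 / (256 * κ) with ha
  -- the bound along the even sides `L = 2(m + L₀ + 1)`
  set u : ℕ → ℝ := fun m =>
    9 * C / ((2 * (m + L₀ + 1) : ℕ) : ℝ) +
      C * Real.exp (-a * (1 - 1 / (1 + 128 * (κ * Real.log ((2 * (m + L₀ + 1) : ℕ) : ℝ))) ^ 2))
    with hu
  have hbound : ∀ m : ℕ, c ≤ u m := by
    intro m
    set L : ℕ := 2 * (m + L₀ + 1) with hL
    haveI : NeZero L := ⟨by omega⟩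
    have hLL₀ : L₀ ≤ L := by omega
    have hev : Even L := ⟨m + L₀ + 1, by omega⟩
    have hL2 : (2 : ℝ) ≤ (L : ℝ) := by exact_mod_cast (show 2 ≤ L by omega)
    have hLpos : (0 : ℝ) < (L : ℝ) := by linarith
    have hlog0 : 0 ≤ Real.log L := Real.log_nonneg (by linarith)
    have hβ : 0 ≤ κ * Real.log L := mul_nonneg hκ.le hlog0
    have hord := hL₀ L hLL₀ hev
    have hmain := re_gibbsState_toBlock_pairField_le L U hβ (p L)
    rw [← hC] at hmain
    have habs : κ * Real.log L * |(1 : ℝ)| = κ * Real.log L := by rw [abs_one, mul_one]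
    rw [habs] at hmain
    set f : ℝ := pairDecayExponent (κ * Real.log L) with hf
    -- `(√L)^{-f} = exp(-a (1 - (1+128κ log L)⁻²))`
    have hsqrt : (Real.sqrt L) ^ (-f) =
        Real.exp (-a * (1 - 1 / (1 + 128 * (κ * Real.log L)) ^ 2)) := by
      rw [Real.rpow_def_of_pos (Real.sqrt_pos.mpr hLpos), Real.log_sqrt hLpos.le]
      congr 1
      have := pairDecayExponent_mul_log hκ hlog0
      rw [← hf] at this
      rw [ha]
      calc Real.log L / 2 * -f = -(f * Real.log L) / 2 := by ring
        _ = -(1 / (128 * κ) * (1 - 1 / (1 + 128 * (κ * Real.log L)) ^ 2)) / 2 := by rw [this]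
        _ = -(1 / (256 * κ)) * (1 - 1 / (1 + 128 * (κ * Real.log L)) ^ 2) := by
            field_simp; ring
    have hL4pos : (0 : ℝ) < (L : ℝ) ^ 4 := by positivity
    have hle : c * (L : ℝ) ^ 4 ≤ (9 * C / L + C * (Real.sqrt L) ^ (-f)) * (L : ℝ) ^ 4 := by
      refine hord.trans (hmain.trans (le_of_eq ?_))
      field_simp
    have hc' : c ≤ 9 * C / L + C * (Real.sqrt L) ^ (-f) := le_of_mul_le_mul_right hle hL4pos
    rw [hsqrt] at hc'
    simpa [hu, hL] using hc'
  -- the limit of the bound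
  have hlim : Tendsto u atTop (𝓝 (0 + C * Real.exp (-a * (1 - 0)))) := by
    have hnat : Tendsto (fun m : ℕ => ((2 * (m + L₀ + 1) : ℕ) : ℝ)) atTop atTop := by
      refine tendsto_natCast_atTop_atTop.comp ?_
      exact (tendsto_add_atTop_nat (L₀ + 1)).const_mul_atTop' two_pos |>.congr fun m => by ring
    have h1 : Tendsto (fun m : ℕ => 9 * C / ((2 * (m + L₀ + 1) : ℕ) : ℝ)) atTop (𝓝 0) :=
      hnat.const_div_atTop (9 * C) |>.congr fun m => rfl
    have hlog : Tendsto (fun m : ℕ => Real.log ((2 * (m + L₀ + 1) : ℕ) : ℝ)) atTop atTop :=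
      Real.tendsto_log_atTop.comp hnat
    have h2 : Tendsto (fun m : ℕ => 1 + 128 * (κ * Real.log ((2 * (m + L₀ + 1) : ℕ) : ℝ)))
        atTop atTop :=
      tendsto_atTop_add_const_left _ 1 ((hlog.const_mul_atTop hκ).const_mul_atTop (by norm_num))
    have h3 : Tendsto (fun m : ℕ =>
        1 / (1 + 128 * (κ * Real.log ((2 * (m + L₀ + 1) : ℕ) : ℝ))) ^ 2) atTop (𝓝 0) := by
      have := (tendsto_pow_atTop two_ne_zero).comp h2
      exact this.const_div_atTop 1
    have h4 : Tendsto (fun m : ℕ => C * Real.exp (-a *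
        (1 - 1 / (1 + 128 * (κ * Real.log ((2 * (m + L₀ + 1) : ℕ) : ℝ))) ^ 2))) atTop
        (𝓝 (C * Real.exp (-a * (1 - 0)))) :=
      ((Real.continuous_exp.tendsto _).comp
        ((tendsto_const_nhds.sub h3).const_mul (-a))).const_mul C
    exact h1.add h4
  have hlim' : Tendsto u atTop (𝓝 (C * Real.exp (-a))) := by
    simpa using hlim
  exact ge_of_tendsto' hlim' hbound |> fun h => by simpa [ha] using h

end Summit.HubbardSuperconductivity.HubbardSuperconductivity.Theorems.LogColdTorus

end
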